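import Summits.QuantumFields.BalabanUV.Beta.D1BFx.PackedMultiplierColumnMass
import Summits.QuantumFields.BalabanUV.Beta.D1BFx.PackedMultiplierSlotLetters
import Summits.QuantumFields.BalabanUV.Beta.D1BFx.PackedStraightColumnMass
import Summits.QuantumFields.BalabanUV.Beta.D1BFx.PackedColumnBlockTotalOfPerSlot
import Summits.QuantumFields.BalabanUV.Beta.GAN24.TaylorLamLeg

/-!
# `BalabanUV.Beta.D1BFx.PackedStraightColumnLambdaMass` — road «BF-x» for binder row D1, slot (K), PART 24 letter «M-pack» AT THE CHART OF RECORD (α′), «K0-LAM-PACK»: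
# **THE (M-b) ROWS OF THE LAGRANGE (Λ-SECTOR) STENCIL `SLam n (lamCoeffOf (KInv n) n) H` AND OF ITS STRAIGHT-PIN VERTEX `V_{SΛ} = vertexOfK K₀ n (SLam …)`, POWERS
# DISPLAYED** — the multiplier-response coefficients `lamCoeffOf (KInv n) n` pay `(n⁵)⁻¹` per coarse slot UNCONDITIONALLY (gan24's `TaylorLamLeg.abs_lamCoeffOf_KInv_le_unit` over
# d1-formalise-leaf-05's `abs_wH_le` via `GamΦ = −wHᵀ`), ONE coarse slot per fine slot's block; the straight `ℋ`-column `(n⁵)⁻¹` against the `n⁴` slots: NET `n⁻⁶ × (table letter)`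

HONEST DEPENDENCY (cell records, verbatim): «continuum YM on T⁴ ⇐ BetaPertH ∧ nine spine estimates (0/9 proved); BetaPertH ⇐ (D1) ∧ (D4) ∧
CAP+tail; G-an2-4 gates asym, D1 and NE2/3/4.»  HONEST FRAMING (cell contract, verbatim): «discharging `BetaPertH` makes Bałaban's UV stability
UNCONDITIONAL — a real constructive-QFT result; it is NOT the continuum limit and NOT the Clay problem.»  THIS MODULE DISCHARGES NOTHING of the
wall: [folklore] `ℓ¹` bookkeeping BY NAME over LANDED objects («K0-MIX-PACK» FILE A′ `mass_sum_wsum_le_of_blockTotal` ∕ `onLat` plumbing, FILE B′ `slotMass_le_of_vertexFamily`, g60 FILE B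
`PackedStraightColumnMass.mass_blk_vertexOfK_K₀_le_of_blockTotal`, FILE 5 `PackedColumnBlockTotalOfPerSlot.blockTotal_le_of_forall_le`, gan24's `GAN24.TaylorLamLeg.abs_lamCoeffOf_KInv_le_unit`,
d1-formalise-leaf-05's `FP.CompositeMinimiserDecay.abs_wH_le` (through g53's `PackedColumnEnvelope`), lit `InterLevelTransport.SLam ∕ onLat ∕ cwsum`, `BalabanStepJets.lamCoeffOf`).  No definition, no
`def … : Prop`, nothing cited, 0 sorry.  Every table letter is a DISPLAYED hypothesis on an ARBITRARY Hessian family `H`; NO (1.22) row is proved; per-word absolute-value letters are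
INTERMEDIATE lemmas (an2 R-D1-g45-4 (3)); 0 root-level binders of row D1 discharged (hW ∕ hR-sockets ∕ hSX-socket ∕ D1Tel ∕ D1Rep = 0); (J1) ONE OPEN ROW; (K) NOT closed; NOT D1,
NEVER «G-an2-4 closed», NOT `BetaPertH`, NOT continuum, NOT Clay.

ABSOLUTE RULE (cell charter, verbatim): «No internally-minted statement may enter as a cited fact. Every hypothesis is either kernel-proved in
this package or a verbatim quotation of a PUBLISHED theorem with page reference. The manuscript(s) under audit are NOT citable for their own
disputed steps — they are the thing under adjudication; programme-internal (2001/route/tribunal) claims are never citable.»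

WHY.  The HEAD (d1-p2 g24 `PART24-HEAD-SPEC-g24.v1_1.md` §0, §2 (H2-Λ)) carries the Λ-sector of the literal's first-order table `S⁰ = n⁴•wilsonA + (−n⁸∕2)•V + cΛ•SΛ`,
`SΛ = SLam n (lamCoeffOf KInv n) symHessFFAt` — in the smooth first-jet family `V^s_{S⁰} := vertexOfK K₀ n S⁰` (R-T's `hVs ∕ hVm` letters; g60 FILE D typed the pure-Wilson sector
hypothesis-free and DISPLAYED the other sectors' counts) and in the displaced word `W^{Λ} := −cΛ•([Λ νy′, V_{SΛ} μy] + [Λ μy, V_{SΛ} νy′])`, `V_{SΛ} := vertexOfK K₀ n SΛ`.  The Λ table is,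
like the multiplier-column vertex, a COARSE superposition (`SLam N c Q2 κ′ u = −Σ_μ cwsum N (y ↦ c μ y κ′ u) (Q2 μ)`), so FILE A′ §1 applies with the weights `onLat n (y ↦ c μ y κ′ u)`;
the coefficients of the one-shot resolvent have the UNCONDITIONAL envelope `|lamCoeffOf (KInv n) n μ y κ′ u| ≤ (3⁴·4·64·C₄·(n⁵)⁻¹·e^{κ′})·e^{−κ′‖quo n u − y‖∞}` (the multiplier–field block
of `KInv` is `−wHᵀ`, `ResolventComposition.GamΦ_eq_neg_wH`; `abs_wH_le`), i.e. the SAME unit `n⁻⁵` and block rate `κ′ = kappa163 4 ∕ 4` as the straight `ℋ`-column.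

CONTENT (`d = 3`; `C₄ := MG163 4·periodConst (kappa163 4) 3`, `κ′ := kappa163 4 ∕ 4`, `CΛ := 3⁴·4·(16·4)·(C₄·(n⁵)⁻¹)·e^{κ′}` as printed by `abs_lamCoeffOf_KInv_le_unit`; block side `n`, `[NeZero n]`).
* §0 [folklore] `abs_blk_SLam_apply` (the blocks of `SLam` are, up to the sign, the coarse superposition `Σ_μ wsum (onLat n (c μ · κ′ u)) (v ↦ blk (onLat n (H μ) v) j k)` — entrywise
  absolute values agree), `abs_wH_le_quo` (`abs_wH_le` in (N1)'s literal shape), **`abs_lamCoeffOf_KInv_road_le`** (the coefficients' envelope in the road's fine `ℓ¹` currency, centred at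
  the block corner `n•blk n u` of the perturbed fine bond: `≤ (CΛ·e^{κ′}·e^{κ′})·e^{−(κ′∕(4n))|n•y − n•blk n u|₁}`).
* §1 [folklore, ANY coefficient family `c` with a displayed coarse envelope, ANY Hessian family `H`]: **`mass_blk_SLam_le_of_slotMass`** (coefficients `|c μ y κ′ u| ≤ C_c·e^{−ρ|n•y − n•y₀|₁}`,
  UNIFORM per-coarse-slot `n•w`-centred weighted masses of `H μ w` `≤ T j k` ⟹ every block of `SLam n c H κ′ u` has weighted mass centred at `n•y₀`, rate `σ ≤ ρ∕4`,
  `≤ 4·(C_c·e^{2ρn}·Zl 4 (ρn∕2))·T j k`).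
* §2 [folklore] the ONE-SHOT coefficients: **`mass_blk_SLam_KInv_le`** (`σ ≤ κ′∕(16n)`: every block of `SLam n (lamCoeffOf (KInv n) n) H κ′ u` has `u`-CENTRED weighted mass
  `≤ (n⁵)⁻¹·KΛ·T j k`, `KΛ := 4·(3⁴·4·64·C₄·e^{κ′}·e^{κ′}·e^{κ′})·e^{κ′∕2}·Zl 4 (κ′∕8)·e^{κ′∕2}` — recentred from the block corner at the cost `e^{κ′∕2}`), **`blockTotal_SLam_KInv_le`**
  (FILE 2's block-total currency: `≤ n⁴·((n⁵)⁻¹·KΛ·T j k)`), **`mass_blk_vertexOfK_K₀_SLam_le`** (g60 FILE B BY NAME: every block of `V_{SΛ} = vertexOfK (KInvStep 3 n 0) n (SLam n (lamCoeffOf (KInv n) n) H) μ y`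
  has centred weighted mass at `n•y` `≤ n⁻¹·(4·C₄e^{κ′}·e^{κ′∕2}·Zl 4 (κ′∕8))·((n⁵)⁻¹·KΛ·T j k)` — NET `n⁻⁶ × T`), **`mass_blk_vertexOfK_K₀_SLam_le_of_vertexFamily`** (`VertexFamily H n C_H δ_H` ⟹
  `T := 16·C_H·Zl 4 (δ_H∕2)²`; the SHAPE of an1's `vertexFamily_symHessFFAt`).
NOT HERE (honest): the scalar `cΛ` (the Λ-lock `cΛ·n⁴ = 2` is the literal's — the consumer multiplies the row by `|cΛ|`); the Λ-sector's transversality (`CombLamSectorLetters`, not a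
mass row); any letter of an1's ACTUAL Hessian table; the brackets with `Λ` (`W^{Λ}`, leaf-01's O-2 currency); any (1.22) row; the PAIRED second variation (the END's closing step).
Unit `b2b-balaban-gan24-formalise-leaf-05` (gen 61), G-an2-4 swarm leaf prover 05, road «BF-x» supplier; INTENT-2 «K0-LAM-PACK» (journal [GAN24LEAF05-G61-INTENT-2] ∕ A-1).
-/

noncomputable section

open Finset
open scoped BigOperators
open Literature.MathematicalPhysics.QuantumFieldTheory
open Literature.MathematicalPhysics.QuantumFieldTheory.LatticeForm (quo)
open Literature.MathematicalPhysics.QuantumFieldTheory.Balaban1983to89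
open Literature.MathematicalPhysics.QuantumFieldTheory.Balaban1983to89.Beta
open B12Sec2to5 (l1 l1_nonneg)
open B4ContourShift (supNorm)
open B5Hk163Strip (kappa163 kappa163_pos)
open B5Hk163Decay (MG163)
open B4TorusKernel (periodConst)
open ExpKernelCalculus (Site MKer Zl Zl_pos Zl_nonneg l1_natSmul)
open AffineAveraging (box toSite)
open AveragingContours (off off_mem_box blk_add_off)
open KernelSpecInstance (wH)
open OneStepResolventKernel (Fib wsum KInv eq_zsmul_quo_of_proj quo_zsmul)
open OneStepKernelFamily (colH KInvStep vertexOfK)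
open InterLevelTransport (onLat cwsum SLam onLat_zsmul onLat_off)
open BalabanStepJets (lamCoeffOf)
open Summit.QuantumFields.BalabanUV.Beta.D1BFx.PackedKernelSplit (blk)
open Summit.QuantumFields.BalabanUV.Beta.D1BFx.RestJetBlockMass (stencil_mass_recentre)
open Summit.QuantumFields.BalabanUV.Beta.GAN24.EnvelopeBlockSum (env_le_exp_l1)
open Summit.QuantumFields.BalabanUV.Beta.FP.CompositeMinimiserDecay (abs_wH_le)
open Summit.QuantumFields.BalabanUV.Beta.GAN24.TaylorLamLeg (abs_lamCoeffOf_KInv_le_unit)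
open Summit.QuantumFields.BalabanUV.Beta.D1BFx.PackedColumnBlockTotalMass (l1_toSite_le_of_mem_box)
open Summit.QuantumFields.BalabanUV.Beta.D1BFx.PackedColumnBlockTotalOfPerSlot (blockTotal_le_of_forall_le)
open Summit.QuantumFields.BalabanUV.Beta.D1BFx.PackedStraightColumnMass (mass_blk_vertexOfK_K₀_le_of_blockTotal)
open Summit.QuantumFields.BalabanUV.Beta.D1BFx.PackedMultiplierColumnMass (abs_onLat_le_of_coarse sum_box_onLat weightedMass_blk_onLat mass_sum_wsum_le_of_blockTotal)
open Summit.QuantumFields.BalabanUV.Beta.D1BFx.PackedMultiplierSlotLetters (slotMass_le_of_vertexFamily)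

namespace Summit.QuantumFields.BalabanUV.Beta.D1BFx.PackedStraightColumnLambdaMass

variable (n : ℕ) [NeZero n]

/-! ## §0 Plumbing: the blocks of `SLam` as a signed coarse superposition; the one-shot coefficients' envelope in the road's currency -/

omit [NeZero n] in
/-- [folklore] THE BLOCKS OF THE LAGRANGE STENCIL ARE, UP TO THE SIGN, A COARSE SUPERPOSITION (unfolding `SLam` ∕ `cwsum`; entrywise absolute values):
`|blk (SLam n c H κ′ u) j k x z a b| = |(Σ_μ wsum (onLat n (y ↦ c μ y κ′ u)) (v ↦ blk (onLat n (H μ) v) j k)) x z a b|`. -/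
theorem abs_blk_SLam_apply (c : Fin (3 + 1) → (Fin (3 + 1) → ℤ) → Fin (3 + 1) → (Fin (3 + 1) → ℤ) → ℝ)
    (H : Fin (3 + 1) → (Fin (3 + 1) → ℤ) → MKer 4 (Fib 3)) (κ' : Fin (3 + 1)) (u : Fin (3 + 1) → ℤ) (j k : Bool) (x z : Site 4) (a b : Fin (3 + 1)) :
    |blk (SLam n c H κ' u) j k x z a b|
      = |(∑ μ : Fin (3 + 1), wsum (onLat n (fun y => c μ y κ' u)) (fun v => blk (onLat n (H μ) v) j k)) x z a b| := by
  simp only [PackedKernelSplit.blk, InterLevelTransport.SLam, InterLevelTransport.cwsum, OneStepResolventKernel.wsum, Finset.sum_apply, abs_neg]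

/-- [folklore] `abs_wH_le` IN (N1)'s LITERAL SHAPE (every fine point, coarse origin): `|wH^{(n)} κ l z| ≤ (C₄·(n⁵)⁻¹)·e^{−κ′·‖quo n z‖∞}`. -/
theorem abs_wH_le_quo (κ l : Fin (3 + 1)) (z : Fin (3 + 1) → ℤ) :
    |wH (N := n) κ l z| ≤ (MG163 4 * periodConst (kappa163 4) 3) * ((n : ℝ) ^ 5)⁻¹ * Real.exp (-(kappa163 4 / 4 * supNorm (quo n z))) := by
  have hN : 1 ≤ n := Nat.one_le_iff_ne_zero.mpr (NeZero.ne n)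
  have h := abs_wH_le (d := 3) n hN κ l z 0
  rw [smul_zero, sub_zero, sub_zero] at h
  refine h.trans (le_of_eq ?_)
  have e3 : ((3 : ℕ) : ℝ) + 1 = 4 := by norm_num
  simp only [e3]
  show ((n : ℝ) ^ (3 + 2))⁻¹ * (MG163 (3 + 1) * periodConst (kappa163 (3 + 1)) 3) * Real.exp (-(kappa163 (3 + 1) / 4 * supNorm (quo n z)))
    = MG163 4 * periodConst (kappa163 4) 3 * ((n : ℝ) ^ 5)⁻¹ * Real.exp (-(kappa163 4 / 4 * supNorm (quo n z)))
  ring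

/-- [folklore] **THE ONE-SHOT MULTIPLIER-RESPONSE COEFFICIENTS IN THE ROAD's CURRENCY** (UNCONDITIONAL): for every perturbed fine bond `(κ′, u)` and every coarse `(μ, y)`,
`|lamCoeffOf (KInv n) n μ y κ′ u| ≤ ((n⁵)⁻¹·CΛ₀)·e^{−(κ′∕(4n))·|n•y − n•blk n u|₁}` with `CΛ₀ := 3⁴·4·(16·4)·C₄·e^{κ′}·e^{κ′}·e^{κ′}` — `TaylorLamLeg.abs_lamCoeffOf_KInv_le_unit` fed `abs_wH_le_quo`
(block sup-norm, centred at `quo n u`), moved to the fine `ℓ¹` currency by `env_le_exp_l1` and recentred at the block corner `n•blk n u` (`|u − n•blk n u|₁ ≤ 4n`: one more `e^{κ′}`). -/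
theorem abs_lamCoeffOf_KInv_road_le (μ : Fin (3 + 1)) (y : Fin (3 + 1) → ℤ) (κ' : Fin (3 + 1)) (u : Fin (3 + 1) → ℤ) :
    |lamCoeffOf (KInv (N := n)) n μ y κ' u|
      ≤ (((n : ℝ) ^ 5)⁻¹ * ((3 : ℝ) ^ (3 + 1) * ((3 + 1 : ℕ) : ℝ) * (16 * ((3 + 1 : ℕ) : ℝ)) * (MG163 4 * periodConst (kappa163 4) 3)
            * Real.exp (kappa163 4 / 4) * Real.exp (kappa163 4 / 4) * Real.exp (kappa163 4 / 4)))
        * Real.exp (-(kappa163 4 / 4 / (4 * (n : ℝ))) * l1 ((n : ℤ) • y - (n : ℤ) • AveragingContours.blk n u)) := by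
  have hN : 1 ≤ n := Nat.one_le_iff_ne_zero.mpr (NeZero.ne n)
  have hn0 : (0 : ℝ) < (n : ℝ) := by exact_mod_cast Nat.pos_of_ne_zero (NeZero.ne n)
  have hκ : 0 ≤ kappa163 4 / 4 := div_nonneg (kappa163_pos 4).le (by norm_num)
  have hC : 0 ≤ MG163 4 * periodConst (kappa163 4) 3 := by
    have h0 := (abs_nonneg _).trans (abs_wH_le_quo n 0 0 0)
    have hq : supNorm (quo n (0 : Fin (3 + 1) → ℤ)) = 0 := by
      rw [show quo n (0 : Fin (3 + 1) → ℤ) = 0 from by simpa using quo_zsmul (N := n) (0 : Fin (3 + 1) → ℤ)]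
      simp [B4ContourShift.supNorm]
    rw [hq, mul_zero, neg_zero, Real.exp_zero, mul_one] at h0
    exact nonneg_of_mul_nonneg_left (by simpa [mul_comm] using h0) (by positivity)
  -- (N1)'s shape ⟹ TaylorLamLeg's block envelope centred at `quo n u`
  have h1 := abs_lamCoeffOf_KInv_le_unit (d := 3) (N := n) (C := MG163 4 * periodConst (kappa163 4) 3) (𝓊 := ((n : ℝ) ^ 5)⁻¹)
    (κ₀ := kappa163 4 / 4) hC (by positivity) hκ (fun κ l z => abs_wH_le_quo n κ l z) μ y κ' u
  -- block sup-norm ⟹ fine `ℓ¹` centred at `u`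
  have h2 := env_le_exp_l1 (d := 3) hN hκ y u
  -- recentre at the block corner `c₀ := n • blk n u`
  set c₀ : Fin (3 + 1) → ℤ := (n : ℤ) • AveragingContours.blk n u with hc₀
  set a : ℝ := kappa163 4 / 4 / (4 * (n : ℝ)) with ha
  have ha0 : 0 ≤ a := by positivity
  have hoff : l1 (u - c₀) ≤ 4 * (n : ℝ) := by
    have e : u - c₀ = toSite (off n u) := by
      rw [hc₀, sub_eq_iff_eq_add']
      exact (blk_add_off hN u).symm
    rw [e]
    refine (l1_toSite_le_of_mem_box (off_mem_box hN u)).trans (le_of_eq ?_)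
    push_cast; ring
  have h3 : Real.exp (-(kappa163 4 / 4 / (((3 : ℝ) + 1) * n)) * l1 (u - (n : ℤ) • y))
      ≤ Real.exp (kappa163 4 / 4) * Real.exp (-a * l1 ((n : ℤ) • y - c₀)) := by
    rw [← Real.exp_add]
    refine Real.exp_le_exp.2 ?_
    have t : l1 ((n : ℤ) • y - c₀) ≤ l1 ((n : ℤ) • y - u) + l1 (u - c₀) := ExpKernelCalculus.l1_sub_triangle _ u _
    rw [ExpKernelCalculus.l1_sub_symm ((n : ℤ) • y) u] at t
    have e4 : ((3 : ℝ) + 1) * n = 4 * (n : ℝ) := by ring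
    rw [e4, ← ha]
    have han : a * (4 * (n : ℝ)) = kappa163 4 / 4 := by rw [ha]; field_simp
    nlinarith [t, hoff, ha0, l1_nonneg ((n : ℤ) • y - c₀), l1_nonneg (u - (n : ℤ) • y)]
  have hpos : 0 ≤ (3 : ℝ) ^ (3 + 1) * ((3 + 1 : ℕ) : ℝ) * (16 * ((3 + 1 : ℕ) : ℝ)) * ((MG163 4 * periodConst (kappa163 4) 3) * ((n : ℝ) ^ 5)⁻¹)
      * Real.exp (kappa163 4 / 4) := by positivity
  calc |lamCoeffOf (KInv (N := n)) n μ y κ' u|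
      ≤ ((3 : ℝ) ^ (3 + 1) * ((3 + 1 : ℕ) : ℝ) * (16 * ((3 + 1 : ℕ) : ℝ)) * ((MG163 4 * periodConst (kappa163 4) 3) * ((n : ℝ) ^ 5)⁻¹)
          * Real.exp (kappa163 4 / 4)) * Real.exp (-(kappa163 4 / 4 * supNorm (quo n u - y))) := h1
    _ ≤ ((3 : ℝ) ^ (3 + 1) * ((3 + 1 : ℕ) : ℝ) * (16 * ((3 + 1 : ℕ) : ℝ)) * ((MG163 4 * periodConst (kappa163 4) 3) * ((n : ℝ) ^ 5)⁻¹)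
          * Real.exp (kappa163 4 / 4)) * (Real.exp (kappa163 4 / 4) * (Real.exp (kappa163 4 / 4) * Real.exp (-a * l1 ((n : ℤ) • y - c₀)))) := by
        refine mul_le_mul_of_nonneg_left (h2.trans (mul_le_mul_of_nonneg_left h3 (Real.exp_pos _).le)) hpos
    _ = _ := by rw [ha]; ring

/-! ## §1 Generic coefficients: the block masses of the Lagrange stencil from a coarse coefficient envelope and uniform Hessian slot masses -/

/-- [folklore] **THE (M-b) ROW OF THE LAGRANGE STENCIL, ANY COEFFICIENT FAMILY** («K-LAM-MASS»; the twin of FILE A′ `mass_blk_vertexOfM_le_of_slotMass` with the weights `c μ · κ′ u` for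
`colM`): a coarse coefficient envelope in fine `ℓ¹` units `|c μ y κ′ u| ≤ C_c·e^{−ρ|n•y − n•y₀|₁}` (`0 < ρ`, `0 ≤ C_c`), `0 ≤ σ ≤ ρ∕4`, and a Hessian family `H μ w` (one kernel per COARSE
bond) whose blocks have summable `n•w`-centred `σ`-weighted masses UNIFORMLY `≤ T j k` ⟹ every block of `SLam n c H κ′ u` has weighted mass centred at `n•y₀`, rate `σ`, summable and
`≤ 4·(C_c·e^{2ρn}·Zl 4 (ρn∕2))·T j k` (FILE A′ §1 with the weights `onLat n (c μ · κ′ u)`; `sum_box_onLat`: ONE coarse slot per block). -/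
theorem mass_blk_SLam_le_of_slotMass {c : Fin (3 + 1) → (Fin (3 + 1) → ℤ) → Fin (3 + 1) → (Fin (3 + 1) → ℤ) → ℝ}
    {H : Fin (3 + 1) → (Fin (3 + 1) → ℤ) → MKer 4 (Fib 3)} {Cc ρ σ : ℝ} {T : Bool → Bool → ℝ}
    (hρ : 0 < ρ) (hCc : 0 ≤ Cc) (hσ0 : 0 ≤ σ) (hσ : σ ≤ ρ / 4) (κ' : Fin (3 + 1)) (u : Fin (3 + 1) → ℤ) (y₀ : Fin (3 + 1) → ℤ)
    (hc : ∀ μ y, |c μ y κ' u| ≤ Cc * Real.exp (-ρ * l1 ((n : ℤ) • y - (n : ℤ) • y₀)))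
    (hHs : ∀ μ w j k, Summable fun p : Site 4 × Site 4 =>
      ∑ g, ∑ f, |blk (H μ w) j k p.1 p.2 g f| * Real.exp (σ * (l1 (p.1 - (n : ℤ) • w) + l1 (p.2 - (n : ℤ) • w))))
    (hHm : ∀ μ w j k, ∑' p : Site 4 × Site 4,
      ∑ g, ∑ f, |blk (H μ w) j k p.1 p.2 g f| * Real.exp (σ * (l1 (p.1 - (n : ℤ) • w) + l1 (p.2 - (n : ℤ) • w))) ≤ T j k)
    (j k : Bool) :
    (Summable fun p : Site 4 × Site 4 => ∑ g, ∑ f,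
        |blk (SLam n c H κ' u) j k p.1 p.2 g f| * Real.exp (σ * (l1 (p.1 - (n : ℤ) • y₀) + l1 (p.2 - (n : ℤ) • y₀)))) ∧
      ∑' p : Site 4 × Site 4, ∑ g, ∑ f,
          |blk (SLam n c H κ' u) j k p.1 p.2 g f| * Real.exp (σ * (l1 (p.1 - (n : ℤ) • y₀) + l1 (p.2 - (n : ℤ) • y₀)))
        ≤ 4 * (Cc * Real.exp (2 * ρ * (n : ℝ)) * Zl 4 (ρ * (n : ℝ) / 2)) * T j k := by
  -- the mass function of `blk (SLam …)` IS the mass function of the coarse superposition (entrywise absolute values agree)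
  have hfun : (fun p : Site 4 × Site 4 => ∑ g, ∑ f,
        |blk (SLam n c H κ' u) j k p.1 p.2 g f| * Real.exp (σ * (l1 (p.1 - (n : ℤ) • y₀) + l1 (p.2 - (n : ℤ) • y₀))))
      = fun p => ∑ g, ∑ f, |(∑ μ : Fin (3 + 1), wsum (onLat n (fun y => c μ y κ' u)) (fun v => blk (onLat n (H μ) v) j k)) p.1 p.2 g f|
          * Real.exp (σ * (l1 (p.1 - (n : ℤ) • y₀) + l1 (p.2 - (n : ℤ) • y₀))) := by
    funext p
    refine Finset.sum_congr rfl fun g _ => Finset.sum_congr rfl fun f _ => ?_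
    rw [abs_blk_SLam_apply]
  rw [hfun]
  -- the slots: weighted masses of the extensions by zero, centred at the slot
  have hTs : ∀ (μ : Fin (3 + 1)) (v : Fin (3 + 1) → ℤ), Summable fun p : Site 4 × Site 4 =>
      ∑ g, ∑ f, |blk (onLat n (H μ) v) j k p.1 p.2 g f| * Real.exp (σ * (l1 (p.1 - v) + l1 (p.2 - v))) := by
    intro μ v
    by_cases hv : Literature.Probability.LatticeModels.Torus.proj n v = 0
    · have e := eq_zsmul_quo_of_proj (N := n) hv
      have h := hHs μ (quo n v) j k
      rw [← e] at h
      simp only [onLat, hv, if_true]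
      exact h
    · simp only [onLat, hv, if_false]
      have h0 : (fun p : Site 4 × Site 4 => ∑ g : Fin (3 + 1), ∑ f : Fin (3 + 1),
          |blk (0 : MKer 4 (Fib 3)) j k p.1 p.2 g f| * Real.exp (σ * (l1 (p.1 - v) + l1 (p.2 - v)))) = fun _ => 0 := by
        funext p
        refine Finset.sum_eq_zero fun g _ => Finset.sum_eq_zero fun f _ => ?_
        simp [PackedKernelSplit.blk]
      rw [h0]
      exact summable_zero
  have hTB : ∀ (μ : Fin (3 + 1)) (y₁ : Fin (3 + 1) → ℤ), ∑ b ∈ box (3 + 1) n,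
      (∑' p : Site 4 × Site 4, ∑ g, ∑ f, |blk (onLat n (H μ) ((n : ℤ) • y₁ + toSite b)) j k p.1 p.2 g f|
        * Real.exp (σ * (l1 (p.1 - ((n : ℤ) • y₁ + toSite b)) + l1 (p.2 - ((n : ℤ) • y₁ + toSite b))))) ≤ T j k := by
    intro μ y₁
    have e : ∀ b ∈ box (3 + 1) n,
        (∑' p : Site 4 × Site 4, ∑ g, ∑ f, |blk (onLat n (H μ) ((n : ℤ) • y₁ + toSite b)) j k p.1 p.2 g f|
          * Real.exp (σ * (l1 (p.1 - ((n : ℤ) • y₁ + toSite b)) + l1 (p.2 - ((n : ℤ) • y₁ + toSite b)))))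
        = onLat n (fun w => ∑' p : Site 4 × Site 4, ∑ g, ∑ f,
            |blk (H μ w) j k p.1 p.2 g f| * Real.exp (σ * (l1 (p.1 - (n : ℤ) • w) + l1 (p.2 - (n : ℤ) • w)))) ((n : ℤ) • y₁ + toSite b) :=
      fun b _ => weightedMass_blk_onLat (H μ) j k σ _
    rw [Finset.sum_congr rfl e, sum_box_onLat]
    exact hHm μ y₁ j k
  have h := mass_sum_wsum_le_of_blockTotal n (ι := Fin (3 + 1)) (w := fun μ => onLat n (fun y => c μ y κ' u))
    (T := fun μ v => blk (onLat n (H μ) v) j k) (mT := T j k) hρ hCc hσ0 hσ y₀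
    (fun μ v => abs_onLat_le_of_coarse (y' := y₀) hCc (hc μ) v) hTs hTB
  refine ⟨h.1, h.2.trans (le_of_eq ?_)⟩
  rw [Fintype.card_fin]
  push_cast
  ring

/-! ## §2 The ONE-SHOT coefficients `lamCoeffOf (KInv n) n`: the Λ table's slot masses pay `(n⁵)⁻¹`; its straight-pin vertex `V_{SΛ}` NET `n⁻⁶ × T` -/

/-- [folklore] **«K0-LAM-MASS» — THE SLOT MASSES OF THE ONE-SHOT LAGRANGE STENCIL, POWER DISPLAYED** (UNCONDITIONAL in the coefficients): for `0 ≤ σ ≤ κ′∕(16n)` and a Hessian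
family `H μ w` with summable `n•w`-centred `σ`-weighted block masses UNIFORMLY `≤ T j k`, every block of `SLam n (lamCoeffOf (KInv n) n) H κ′ u` has `u`-CENTRED `σ`-weighted mass,
summable and `≤ ((n⁵)⁻¹·(4·CΛ₀·e^{κ′∕2}·Zl 4 (κ′∕8))·T j k)·e^{κ′∕2}` — §1 at the block corner `n•blk n u` (rate `κ′∕(4n)`), recentred to `u` (`|n•blk n u − u|₁ ≤ 4n` ⟹ `e^{2σ·4n} ≤ e^{κ′∕2}`). -/
theorem mass_blk_SLam_KInv_le {H : Fin (3 + 1) → (Fin (3 + 1) → ℤ) → MKer 4 (Fib 3)} {σ : ℝ} {T : Bool → Bool → ℝ}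
    (hσ0 : 0 ≤ σ) (hσ : σ ≤ kappa163 4 / 4 / (16 * (n : ℝ)))
    (hHs : ∀ μ w j k, Summable fun p : Site 4 × Site 4 =>
      ∑ g, ∑ f, |blk (H μ w) j k p.1 p.2 g f| * Real.exp (σ * (l1 (p.1 - (n : ℤ) • w) + l1 (p.2 - (n : ℤ) • w))))
    (hHm : ∀ μ w j k, ∑' p : Site 4 × Site 4,
      ∑ g, ∑ f, |blk (H μ w) j k p.1 p.2 g f| * Real.exp (σ * (l1 (p.1 - (n : ℤ) • w) + l1 (p.2 - (n : ℤ) • w))) ≤ T j k)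
    (κ' : Fin (3 + 1)) (u : Fin (3 + 1) → ℤ) (j k : Bool) :
    (Summable fun p : Site 4 × Site 4 => ∑ g, ∑ f,
        |blk (SLam n (lamCoeffOf (KInv (N := n)) n) H κ' u) j k p.1 p.2 g f| * Real.exp (σ * (l1 (p.1 - u) + l1 (p.2 - u)))) ∧
      ∑' p : Site 4 × Site 4, ∑ g, ∑ f,
          |blk (SLam n (lamCoeffOf (KInv (N := n)) n) H κ' u) j k p.1 p.2 g f| * Real.exp (σ * (l1 (p.1 - u) + l1 (p.2 - u)))
        ≤ (((n : ℝ) ^ 5)⁻¹ * (4 * ((3 : ℝ) ^ (3 + 1) * ((3 + 1 : ℕ) : ℝ) * (16 * ((3 + 1 : ℕ) : ℝ)) * (MG163 4 * periodConst (kappa163 4) 3)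
              * Real.exp (kappa163 4 / 4) * Real.exp (kappa163 4 / 4) * Real.exp (kappa163 4 / 4))
            * Real.exp (kappa163 4 / 4 / 2) * Zl 4 (kappa163 4 / 4 / 8)) * T j k) * Real.exp (kappa163 4 / 4 / 2) := by
  have hN : 1 ≤ n := Nat.one_le_iff_ne_zero.mpr (NeZero.ne n)
  have hn0 : (0 : ℝ) < (n : ℝ) := by exact_mod_cast Nat.pos_of_ne_zero (NeZero.ne n)
  have hκ : 0 < kappa163 4 / 4 := div_pos (kappa163_pos 4) (by norm_num)
  set ρ : ℝ := kappa163 4 / 4 / (4 * (n : ℝ)) with hρ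
  have hρ0 : 0 < ρ := by positivity
  have hσ' : σ ≤ ρ / 4 := by
    refine hσ.trans (le_of_eq ?_)
    rw [hρ]; field_simp; ring
  set Cc : ℝ := ((n : ℝ) ^ 5)⁻¹ * ((3 : ℝ) ^ (3 + 1) * ((3 + 1 : ℕ) : ℝ) * (16 * ((3 + 1 : ℕ) : ℝ)) * (MG163 4 * periodConst (kappa163 4) 3)
      * Real.exp (kappa163 4 / 4) * Real.exp (kappa163 4 / 4) * Real.exp (kappa163 4 / 4)) with hCc
  have hCc0 : 0 ≤ Cc := by
    have h0 := (abs_nonneg _).trans (abs_lamCoeffOf_KInv_road_le n 0 0 0 0)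
    exact (mul_nonneg_iff_of_pos_right (Real.exp_pos _)).1 h0
  set c₀ : Fin (3 + 1) → ℤ := (n : ℤ) • AveragingContours.blk n u with hc₀
  -- §1 at the block corner
  obtain ⟨hs, hb⟩ := mass_blk_SLam_le_of_slotMass n (c := lamCoeffOf (KInv (N := n)) n) (H := H) (T := T) hρ0 hCc0 hσ0 hσ' κ' u
    (AveragingContours.blk n u) (fun μ y => abs_lamCoeffOf_KInv_road_le n μ y κ' u) hHs hHm j k
  -- recentre from `c₀ = n • blk n u` to `u`
  have hoff : l1 (c₀ - u) ≤ 4 * (n : ℝ) := by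
    have e : u - c₀ = toSite (off n u) := by
      rw [hc₀, sub_eq_iff_eq_add']
      exact (blk_add_off hN u).symm
    rw [ExpKernelCalculus.l1_sub_symm, e]
    refine (l1_toSite_le_of_mem_box (off_mem_box hN u)).trans (le_of_eq ?_)
    push_cast; ring
  obtain ⟨hs', hb'⟩ := stencil_mass_recentre hσ0 c₀ u hs hb
  refine ⟨hs', hb'.trans ?_⟩
  have e1 : 2 * ρ * (n : ℝ) = kappa163 4 / 4 / 2 := by rw [hρ]; field_simp; ring
  have e2 : ρ * (n : ℝ) / 2 = kappa163 4 / 4 / 8 := by rw [hρ]; field_simp; ring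
  rw [e1, e2]
  have hexp : Real.exp (2 * σ * l1 (c₀ - u)) ≤ Real.exp (kappa163 4 / 4 / 2) := by
    refine Real.exp_le_exp.2 ?_
    have h1 : 2 * σ * l1 (c₀ - u) ≤ 2 * σ * (4 * (n : ℝ)) := by nlinarith [hoff, hσ0, l1_nonneg (c₀ - u)]
    have h2 : 2 * σ * (4 * (n : ℝ)) ≤ 2 * (kappa163 4 / 4 / (16 * (n : ℝ))) * (4 * (n : ℝ)) := by nlinarith [hσ, hn0]
    have h3 : 2 * (kappa163 4 / 4 / (16 * (n : ℝ))) * (4 * (n : ℝ)) = kappa163 4 / 4 / 2 := by field_simp; ring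
    linarith
  have hT0 : 0 ≤ T j k := le_trans (tsum_nonneg fun p => Finset.sum_nonneg fun g _ => Finset.sum_nonneg fun f _ => by positivity) (hHm 0 0 j k)
  have hM0 : 0 ≤ 4 * (Cc * Real.exp (kappa163 4 / 4 / 2) * Zl 4 (kappa163 4 / 4 / 8)) * T j k := by
    have := Zl_nonneg (D := 4) (c := kappa163 4 / 4 / 8) (by positivity)
    positivity
  calc 4 * (Cc * Real.exp (kappa163 4 / 4 / 2) * Zl 4 (kappa163 4 / 4 / 8)) * T j k * Real.exp (2 * σ * l1 (c₀ - u))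
      ≤ 4 * (Cc * Real.exp (kappa163 4 / 4 / 2) * Zl 4 (kappa163 4 / 4 / 8)) * T j k * Real.exp (kappa163 4 / 4 / 2) :=
        mul_le_mul_of_nonneg_left hexp hM0
    _ = _ := by rw [hCc]; ring

/-- [folklore] **THE BLOCK TOTALS OF THE ONE-SHOT Λ TABLE IN FILE 2's CURRENCY** (`hSB` of g60 FILE B `mass_blk_vertexOfK_K₀_le_of_blockTotal`): under the hypotheses of
`mass_blk_SLam_KInv_le`, `Σ_{b ∈ box 4 n} (u-centred mass at u = n•y′ + b) ≤ n⁴·(((n⁵)⁻¹·(4·CΛ₀·e^{κ′∕2}·Zl 4 (κ′∕8))·T j k)·e^{κ′∕2})` (FILE 5 `blockTotal_le_of_forall_le`). -/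
theorem blockTotal_SLam_KInv_le {H : Fin (3 + 1) → (Fin (3 + 1) → ℤ) → MKer 4 (Fib 3)} {σ : ℝ} {T : Bool → Bool → ℝ}
    (hσ0 : 0 ≤ σ) (hσ : σ ≤ kappa163 4 / 4 / (16 * (n : ℝ)))
    (hHs : ∀ μ w j k, Summable fun p : Site 4 × Site 4 =>
      ∑ g, ∑ f, |blk (H μ w) j k p.1 p.2 g f| * Real.exp (σ * (l1 (p.1 - (n : ℤ) • w) + l1 (p.2 - (n : ℤ) • w))))
    (hHm : ∀ μ w j k, ∑' p : Site 4 × Site 4,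
      ∑ g, ∑ f, |blk (H μ w) j k p.1 p.2 g f| * Real.exp (σ * (l1 (p.1 - (n : ℤ) • w) + l1 (p.2 - (n : ℤ) • w))) ≤ T j k)
    (κ' : Fin (3 + 1)) (y' : Fin (3 + 1) → ℤ) (j k : Bool) :
    ∑ b ∈ box (3 + 1) n,
      (∑' p : Site 4 × Site 4, ∑ g, ∑ f, |blk (SLam n (lamCoeffOf (KInv (N := n)) n) H κ' ((n : ℤ) • y' + toSite b)) j k p.1 p.2 g f|
        * Real.exp (σ * (l1 (p.1 - ((n : ℤ) • y' + toSite b)) + l1 (p.2 - ((n : ℤ) • y' + toSite b)))))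
      ≤ (n : ℝ) ^ 4 * ((((n : ℝ) ^ 5)⁻¹ * (4 * ((3 : ℝ) ^ (3 + 1) * ((3 + 1 : ℕ) : ℝ) * (16 * ((3 + 1 : ℕ) : ℝ)) * (MG163 4 * periodConst (kappa163 4) 3)
              * Real.exp (kappa163 4 / 4) * Real.exp (kappa163 4 / 4) * Real.exp (kappa163 4 / 4))
            * Real.exp (kappa163 4 / 4 / 2) * Zl 4 (kappa163 4 / 4 / 8)) * T j k) * Real.exp (kappa163 4 / 4 / 2)) := by
  have h := blockTotal_le_of_forall_le (D := 3 + 1) (n := n)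
    (m := fun u => ∑' p : Site 4 × Site 4, ∑ g, ∑ f, |blk (SLam n (lamCoeffOf (KInv (N := n)) n) H κ' u) j k p.1 p.2 g f|
      * Real.exp (σ * (l1 (p.1 - u) + l1 (p.2 - u))))
    (fun u => (mass_blk_SLam_KInv_le n hσ0 hσ hHs hHm κ' u j k).2) y'
  refine h.trans (le_of_eq ?_)
  norm_num

/-- [folklore] **«K0-LAM-VERTEX-MASS» — THE (M-b) ROW OF THE Λ-SECTOR's STRAIGHT-PIN VERTEX `V_{SΛ}`, POWERS DISPLAYED** (g60 FILE B `mass_blk_vertexOfK_K₀_le_of_blockTotal` BY NAME on the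
block totals above): for `0 ≤ σ ≤ κ′∕(16n)` and a Hessian family with uniform slot masses `≤ T j k`, every block of `vertexOfK (KInvStep 3 n 0) n (SLam n (lamCoeffOf (KInv n) n) H) μ y` has
centred weighted mass at `n•y`, rate `σ`, summable and `≤ n⁻¹·(4·C₄e^{κ′}·e^{κ′∕2}·Zl 4 (κ′∕8))·(((n⁵)⁻¹·(4·CΛ₀·e^{κ′∕2}·Zl 4 (κ′∕8))·T j k)·e^{κ′∕2})` — NET `n⁻⁶ × T j k`: the straight
`ℋ`-column pays `n⁻⁵` against the `n⁴` slots, the coefficients `n⁻⁵` against ONE coarse slot. -/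
theorem mass_blk_vertexOfK_K₀_SLam_le {H : Fin (3 + 1) → (Fin (3 + 1) → ℤ) → MKer 4 (Fib 3)} {σ : ℝ} {T : Bool → Bool → ℝ}
    (hσ0 : 0 ≤ σ) (hσ : σ ≤ kappa163 4 / 4 / (16 * (n : ℝ)))
    (hHs : ∀ μ w j k, Summable fun p : Site 4 × Site 4 =>
      ∑ g, ∑ f, |blk (H μ w) j k p.1 p.2 g f| * Real.exp (σ * (l1 (p.1 - (n : ℤ) • w) + l1 (p.2 - (n : ℤ) • w))))
    (hHm : ∀ μ w j k, ∑' p : Site 4 × Site 4,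
      ∑ g, ∑ f, |blk (H μ w) j k p.1 p.2 g f| * Real.exp (σ * (l1 (p.1 - (n : ℤ) • w) + l1 (p.2 - (n : ℤ) • w))) ≤ T j k)
    (μ : Fin (3 + 1)) (y : Fin (3 + 1) → ℤ) (j k : Bool) :
    (Summable fun p : Site 4 × Site 4 => ∑ g, ∑ f,
        |blk (vertexOfK (KInvStep (d := 3) n 0) n (SLam n (lamCoeffOf (KInv (N := n)) n) H) μ y) j k p.1 p.2 g f|
          * Real.exp (σ * (l1 (p.1 - (n : ℤ) • y) + l1 (p.2 - (n : ℤ) • y)))) ∧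
      ∑' p : Site 4 × Site 4, ∑ g, ∑ f,
          |blk (vertexOfK (KInvStep (d := 3) n 0) n (SLam n (lamCoeffOf (KInv (N := n)) n) H) μ y) j k p.1 p.2 g f|
            * Real.exp (σ * (l1 (p.1 - (n : ℤ) • y) + l1 (p.2 - (n : ℤ) • y)))
        ≤ (n : ℝ)⁻¹ * (4 * ((MG163 4 * periodConst (kappa163 4) 3) * Real.exp (kappa163 4 / 4))
            * Real.exp (kappa163 4 / 4 / 2) * Zl 4 (kappa163 4 / 4 / 8))
          * ((((n : ℝ) ^ 5)⁻¹ * (4 * ((3 : ℝ) ^ (3 + 1) * ((3 + 1 : ℕ) : ℝ) * (16 * ((3 + 1 : ℕ) : ℝ)) * (MG163 4 * periodConst (kappa163 4) 3)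
              * Real.exp (kappa163 4 / 4) * Real.exp (kappa163 4 / 4) * Real.exp (kappa163 4 / 4))
            * Real.exp (kappa163 4 / 4 / 2) * Zl 4 (kappa163 4 / 4 / 8)) * T j k) * Real.exp (kappa163 4 / 4 / 2)) :=
  mass_blk_vertexOfK_K₀_le_of_blockTotal n hσ0 hσ
    (fun κ' u j k => (mass_blk_SLam_KInv_le n hσ0 hσ hHs hHm κ' u j k).1)
    (fun κ' y' j k => blockTotal_SLam_KInv_le n hσ0 hσ hHs hHm κ' y' j k) μ y j k

/-- [folklore] **THE SAME ROW FROM A `VertexFamily` LETTER OF THE HESSIAN TABLE** (the SHAPE of an1's `vertexFamily_symHessFFAt`): `VertexFamily H n C_H δ_H` (`0 < δ_H`), `σ ≤ δ_H∕2`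
additionally ⟹ `T j k := 16·C_H·Zl 4 (δ_H∕2)²` (FILE B′ `slotMass_le_of_vertexFamily`). -/
theorem mass_blk_vertexOfK_K₀_SLam_le_of_vertexFamily {H : Fin (3 + 1) → (Fin (3 + 1) → ℤ) → MKer 4 (Fib 3)} {CH δH σ : ℝ}
    (hH : ExpKernelCalculus.VertexFamily H n CH δH) (hδH : 0 < δH)
    (hσ0 : 0 ≤ σ) (hσ : σ ≤ kappa163 4 / 4 / (16 * (n : ℝ))) (hσH : σ ≤ δH / 2)
    (μ : Fin (3 + 1)) (y : Fin (3 + 1) → ℤ) (j k : Bool) :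
    (Summable fun p : Site 4 × Site 4 => ∑ g, ∑ f,
        |blk (vertexOfK (KInvStep (d := 3) n 0) n (SLam n (lamCoeffOf (KInv (N := n)) n) H) μ y) j k p.1 p.2 g f|
          * Real.exp (σ * (l1 (p.1 - (n : ℤ) • y) + l1 (p.2 - (n : ℤ) • y)))) ∧
      ∑' p : Site 4 × Site 4, ∑ g, ∑ f,
          |blk (vertexOfK (KInvStep (d := 3) n 0) n (SLam n (lamCoeffOf (KInv (N := n)) n) H) μ y) j k p.1 p.2 g f|
            * Real.exp (σ * (l1 (p.1 - (n : ℤ) • y) + l1 (p.2 - (n : ℤ) • y)))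
        ≤ (n : ℝ)⁻¹ * (4 * ((MG163 4 * periodConst (kappa163 4) 3) * Real.exp (kappa163 4 / 4))
            * Real.exp (kappa163 4 / 4 / 2) * Zl 4 (kappa163 4 / 4 / 8))
          * ((((n : ℝ) ^ 5)⁻¹ * (4 * ((3 : ℝ) ^ (3 + 1) * ((3 + 1 : ℕ) : ℝ) * (16 * ((3 + 1 : ℕ) : ℝ)) * (MG163 4 * periodConst (kappa163 4) 3)
              * Real.exp (kappa163 4 / 4) * Real.exp (kappa163 4 / 4) * Real.exp (kappa163 4 / 4))
            * Real.exp (kappa163 4 / 4 / 2) * Zl 4 (kappa163 4 / 4 / 8)) * (16 * CH * Zl 4 (δH / 2) ^ 2)) * Real.exp (kappa163 4 / 4 / 2)) :=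
  mass_blk_vertexOfK_K₀_SLam_le n (T := fun _ _ => 16 * CH * Zl 4 (δH / 2) ^ 2) hσ0 hσ
    (fun μ' w j k => (slotMass_le_of_vertexFamily n hH hδH hσH μ' w j k).1)
    (fun μ' w j k => (slotMass_le_of_vertexFamily n hH hδH hσH μ' w j k).2) μ y j k

end Summit.QuantumFields.BalabanUV.Beta.D1BFx.PackedStraightColumnLambdaMass

end
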